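import Summits.BirchSwinnertonDyer.BirchSwinnertonDyer.Theorems.ByReductionTypeAtTwoTowerNoFiniteSubmoduleOfCasselsTatePackage
import Literature.NumberTheory.EllipticCurves.SubgroupSelmerCorestrictionProofs
import Literature.NumberTheory.EllipticCurves.ShaPrimaryModDivisibleSquare
import Literature.NumberTheory.EllipticCurves.BSDQuadraticDescentCasselsPairingProofs
import Literature.NumberTheory.GaloisRepresentations.AbsGaloisGroupCompact
import HarnessLib

/-!
# Route `ByReductionTypeAtTwo`, TOWER road (items 19271 / 19573 / 19922 / 19923): the PRINT binder `h414`
# (Greenberg LNM 1716 Prop. 4.14 = `Greenberg1999.prop414_noFiniteSubmodule_of_not_dvd_torsionOrder`) on the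
# HACHIMORI–MATSUNO ROAD — displayed residue in the PRINTED SHAPE of the Cassels–Tate pairing: alternating, kernel =
# the divisible elements (Silverman AEC X.4.14 / Milne ADT I.6.13), Galois-equivariant, restriction adjoint to corestriction

HONEST FRAMING (cell `bsd-2adic`, run/shared/lean/pub/bsd-2adic/, seat `bsd-2adic-tower-1` GEN 22, HUMAN RULINGS D-0036 /
D-0054 / D-0074; D-0152: kernel hygiene on a CLASS-route hypothesis, no kit, no desk object): theorems only (no definition, no
named fact, no `sorry`, axioms the standard trio); CONDITIONAL on the displayed pairings; closes no route item; nothing booked;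
BSD is not proved by any of this. `h414` stays displayed on the 429 K4 TOWER / λ-rank files (no re-key from this seat).

WHAT IT PROVES. Fourth step of the road (GEN 21 `…OfLayerPackage` → GEN 22 `…OfCasselsTatePackage` → `…OfCasselsTatePairings`).
The previous step displayed the layer pairings `⟨·,·⟩_n` on `Sel_{p^∞}(E/K_n)` through four DERIVED properties (skew-symmetry,
`p`-divisible right kernel, every character vanishing on the right kernel represented, `conj_γ`-invariance) + adjointness. HERE the
display is the PRINTED shape of the Cassels–Tate pairing, as the tree already words it over a number field
(`WeierstrassCurve.exists_casselsTate_pairing`, Silverman *AEC* X.4.14: "an alternating bilinear pairing whose kernel on each side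
is exactly the subgroup of divisible elements"): for each layer, a biadditive pairing on `Sel_{p^∞}(E/K_n)` which is
(ALT) alternating `⟨x, x⟩ = 0`, (KER) has right kernel EXACTLY the subgroup of divisible elements `AddSubgroup.divisibleElements`,
(GAL) is `conj_γ`-invariant, (ADJ) makes `res_{K_{n+1}/K_n}` adjoint to the kernel corestriction `cor_{K_{n+1}/K_n}`
(`WeierstrassCurve.coresLayer`) — [HachimoriMatsuno2000, p. 2540 L34–37] "non-degenerate skew-symmetric Galois-equivariant
pairing on `C_n = Sel/D_n` … the dual of the restriction map is the corestriction map", `D_n` the maximal divisible subgroup.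
The four properties of the previous step are DERIVED in the kernel: skew-symmetry from (ALT); `p`-divisibility of the right
kernel = of `Sel_n^{div}` and FINITENESS of `C_n = Sel_n / Sel_n^{div}` from the tree's `finite_quot_and_isSquare_natCard_of_pairing`
(`Sel_{p^∞}(E/K_n)` is `p`-primary — a continuous cocycle on the compact `Gal(K̄/K_n)` takes finitely many values,
`exists_pow_nsmul_eq_zero_subgroupH1` — with finite `p`-torsion, `finite_torsionBy_selmerGroupOver`, Silverman X.4.2 (b) at the
layer); representability of every character of `C_n` by Pontryagin counting on the finite group `C_n`
(`#Hom(C_n, ℚ/ℤ) ≤ #C_n`, `natCard_addMonoidHom_addCircle_le`, against the injection `C_n ↪ Hom(C_n, ℚ/ℤ)` given by (KER)).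

* §1 `exists_forall_eq_pair_of_alternating_of_ker` — pure algebra: a `p`-primary group with finite `p`-torsion and an
  alternating `ℚ/ℤ`-pairing with right kernel the divisible elements: the divisible elements form a `p`-divisible subgroup and
  every character vanishing on them is `⟨·, c⟩`.
* §2 `SelmerDualData.forall_finite_eq_bot_of_casselsTateAlternating` — any `K`, `p`, `ℤ_p`-extension, `E(K)[p] = 0`,
  torsion dual datum: (ALT)+(KER)+(GAL)+(ADJ) on the layers ⟹ no non-zero finite `Λ`-submodule.
* §3 `prop414_of_casselsTateAlternating` — over `ℚ`: the same for every (globally minimal elliptic `W`, `p ∤ #E(ℚ)_tors`,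
  cyclotomic `κ`, `γ`) ⟹ the Literature named fact `prop414_noFiniteSubmodule_of_not_dvd_torsionOrder` (binder `h414`).

References: [HachimoriMatsuno2000] Theorem, Cor. (i), proof p. 2540 L28–L45; [GreenbergLNM1716] §4 Prop. 4.14 (pp. 104–105);
[MilneADT2006] I Thm. 6.13, Rem. 6.10; [SilvermanAEC2009] Thm. X.4.14, Ex. 10.20; [Washington1997] Prop. 13.28.
-/

set_option autoImplicit false
-- the Theorems namespace of this sub repeats the summit name by design (D-0017 nested layout: Summit.<S>.<Sub>)
set_option linter.dupNamespace false

noncomputable section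

open scoped Classical

universe u

namespace Summit.BirchSwinnertonDyer.BirchSwinnertonDyer.Theorems.TowerHaMa

open NumberField IsDedekindDomain Field WeierstrassCurve Literature.NumberTheory.EllipticCurves
  Literature.NumberTheory.EllipticCurves.ZpExtension Literature.NumberTheory.GaloisRepresentations
  Summit.BirchSwinnertonDyer.Rank1Residual

/-! ## §1 Pure algebra: alternating `ℚ/ℤ`-pairings with kernel the divisible elements -/

section Algebra

variable {A : Type*} [AddCommGroup A] (p : ℕ) [Fact p.Prime]

/-- An alternating biadditive pairing is skew-symmetric: `⟨y, t⟩ = -⟨t, y⟩` (expand `⟨y + t, y + t⟩ = 0`). [folklore] -/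
theorem pair_eq_neg_of_alternating {C : Type*} [AddCommGroup C] (B : A →+ A →+ C) (halt : ∀ x, B x x = 0)
    (y t : A) : B y t = -B t y := by
  have h := halt (y + t)
  simp only [map_add, AddMonoidHom.add_apply, halt y, halt t, zero_add, add_zero] at h
  exact eq_neg_of_add_eq_zero_right h

/-- **Alternating `ℚ/ℤ`-pairing with right kernel the divisible elements, on a `p`-primary group with finite `p`-torsion:
the divisible elements are `p`-divisible among themselves, and every character vanishing on them is `⟨·, c⟩`.** The quotient
`C = A / A_div` is finite (`finite_quot_and_isSquare_natCard_of_pairing`: `A_div = p^{k₀} A`), the pairing descends to `C` with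
trivial right kernel, so `c ↦ ⟨·, c⟩` injects `C` into `Hom(C, ℚ/ℤ)`, a finite group of order `≤ #C`
(`natCard_addMonoidHom_addCircle_le`); hence it is onto. (Pontryagin duality for the finite group `C_n = Sel/D_n` of
Hachimori–Matsuno; Silverman *AEC* Ex. 10.20.) [cite: SilvermanAEC2009, Thm. X.4.14 and Ex. 10.20] -/
theorem exists_forall_eq_pair_of_alternating_of_ker (hA : ∀ a : A, ∃ n : ℕ, p ^ n • a = 0)
    [Finite (AddSubgroup.torsionBy A (p : ℤ))] (B : A →+ A →+ AddCircle (1 : ℚ)) (halt : ∀ x, B x x = 0)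
    (hker : ∀ t, (∀ y, B y t = 0) ↔ t ∈ AddSubgroup.divisibleElements A) :
    (∀ t, (∀ y, B y t = 0) → ∃ t', (∀ y, B y t' = 0) ∧ p • t' = t) ∧
      ∀ g : A →+ AddCircle (1 : ℚ), (∀ t, (∀ y, B y t = 0) → g t = 0) → ∃ c, ∀ y, g y = B y c := by
  have hskew : ∀ y t, B y t = -B t y := pair_eq_neg_of_alternating B halt
  -- left kernel = right kernel ⊆ `p^k A` for all `k`
  have hkerL : ∀ a, (∀ b, B a b = 0) → ∀ k : ℕ, a ∈ (nsmulAddMonoidHom (α := A) (p ^ k)).range := by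
    intro a ha k
    have ha' : a ∈ AddSubgroup.divisibleElements A :=
      (hker a).mp fun y ↦ by rw [hskew, ha y, neg_zero]
    obtain ⟨y, hy⟩ := (AddSubgroup.mem_divisibleElements_iff A a).mp ha' (p ^ k) (pow_pos (Fact.out : p.Prime).pos k)
    exact ⟨y, hy⟩
  obtain ⟨hdivis, hfin, -⟩ := finite_quot_and_isSquare_natCard_of_pairing p hA B halt hkerL
  set Dv := AddSubgroup.divisibleElements A with hDv
  refine ⟨fun t ht ↦ ?_, fun g hg ↦ ?_⟩
  · obtain ⟨t', ht', h⟩ := hdivis t ((hker t).mp ht) p (Fact.out : p.Prime).pos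
    exact ⟨t', (hker t').mpr ht', h⟩
  · haveI := hfin
    haveI := finite_addMonoidHom_addCircle (A ⧸ Dv)
    -- the pairing descends to `Ψ̄ : A/Dv →+ Hom(A/Dv, ℚ/ℤ)`, `[c] ↦ ([y] ↦ ⟨y, c⟩)`
    have hφ : ∀ c : A, Dv ≤ (B.flip c).ker := fun c y hy ↦ by
      rw [AddMonoidHom.mem_ker, AddMonoidHom.flip_apply, hskew, (hker y).mpr hy c, neg_zero]
    let Ψ : A →+ (A ⧸ Dv →+ AddCircle (1 : ℚ)) :=
      { toFun := fun c ↦ QuotientAddGroup.lift Dv (B.flip c) (hφ c)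
        map_zero' := by
          ext y
          rw [AddMonoidHom.comp_apply, QuotientAddGroup.mk'_apply, QuotientAddGroup.lift_mk, map_zero,
            AddMonoidHom.zero_apply, AddMonoidHom.comp_apply, AddMonoidHom.zero_apply]
        map_add' := fun c₁ c₂ ↦ by
          ext y
          simp only [AddMonoidHom.comp_apply, QuotientAddGroup.mk'_apply, QuotientAddGroup.lift_mk, map_add,
            AddMonoidHom.add_apply] }
    have hΨ : ∀ (c y : A), Ψ c (y : A ⧸ Dv) = B y c := fun c y ↦ by
      change QuotientAddGroup.lift Dv (B.flip c) (hφ c) (y : A ⧸ Dv) = B y c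
      rw [QuotientAddGroup.lift_mk, AddMonoidHom.flip_apply]
    have hΨker : Dv ≤ Ψ.ker := fun c hc ↦ by
      rw [AddMonoidHom.mem_ker]
      ext y
      rw [AddMonoidHom.comp_apply, QuotientAddGroup.mk'_apply, hΨ, (hker c).mpr hc y, AddMonoidHom.comp_apply,
        AddMonoidHom.zero_apply]
    let Ψbar : A ⧸ Dv →+ (A ⧸ Dv →+ AddCircle (1 : ℚ)) := QuotientAddGroup.lift Dv Ψ hΨker
    have hΨbar : ∀ (c y : A), Ψbar (c : A ⧸ Dv) (y : A ⧸ Dv) = B y c := fun c y ↦ by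
      change QuotientAddGroup.lift Dv Ψ hΨker (c : A ⧸ Dv) (y : A ⧸ Dv) = B y c
      rw [QuotientAddGroup.lift_mk, hΨ]
    have hinj : Function.Injective Ψbar := by
      rw [injective_iff_map_eq_zero]
      intro x hx
      induction x using QuotientAddGroup.induction_on with
      | H c =>
        rw [QuotientAddGroup.eq_zero_iff]
        refine (hker c).mp fun y ↦ ?_
        rw [← hΨbar c y, hx, AddMonoidHom.zero_apply]
    have hbij := hinj.bijective_of_nat_card_le (natCard_addMonoidHom_addCircle_le (A ⧸ Dv))
    -- `g` descends to `A/Dv` and is hit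
    have hgD : Dv ≤ g.ker := fun t ht ↦ (AddMonoidHom.mem_ker).mpr (hg t ((hker t).mpr ht))
    obtain ⟨x, hx⟩ := hbij.2 (QuotientAddGroup.lift Dv g hgD)
    induction x using QuotientAddGroup.induction_on with
    | H c =>
      refine ⟨c, fun y ↦ ?_⟩
      rw [← hΨbar c y, hx, QuotientAddGroup.lift_mk]

end Algebra

/-! ## §2 The tree's layers: the Cassels–Tate pairing in its printed shape -/

section Tower

variable {K : Type u} [Field K] [NumberField K] (W : WeierstrassCurve K) [W.IsElliptic] {p : ℕ} [Fact p.Prime]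
  (κ : ZpExtension K p) {γ : Field.absoluteGaloisGroup K}

omit [W.IsElliptic] in
/-- `Sel_{p^∞}(E/K_n)` is `p`-primary: a continuous cocycle on the compact group `Gal(K̄/K_n)` with values in the discrete
`p`-primary module `E[p^∞]` takes finitely many values (`exists_pow_nsmul_eq_zero_subgroupH1`). Greenberg (1999), §2.
[cite: GreenbergLNM1716, §2 (p. 63: `Sel_E(K_n)_p ⊆ H¹(K_n, E[p^∞])`, a `p`-primary group)] -/
theorem exists_pow_nsmul_eq_zero_selmerLayer (n : ℕ) (s : W.selmerLayer κ n) : ∃ k : ℕ, p ^ k • s = 0 := by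
  haveI : CompactSpace (absoluteGaloisGroup K) := absoluteGaloisGroup_compactSpace K
  obtain ⟨k, hk⟩ := exists_pow_nsmul_eq_zero_subgroupH1 (M := geomPrimaryTorsion W p) (κ.layerSubgroup n)
    (Subgroup.isClosed_of_isOpen _ (κ.isOpen_layerSubgroup n)) (primaryComponent_isPrimary (M := geomPoints W) p)
    (s : W.subgroupH1 p (κ.layerSubgroup n))
  exact ⟨k, Subtype.ext (by rw [AddSubgroupClass.coe_nsmul, hk, ZeroMemClass.coe_zero])⟩

/-- `Sel_{p^∞}(E/K_n)[p]` is finite (Silverman X.4.2 (b) over the layer, the tree's `finite_torsionBy_selmerGroupOver`).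
[cite: SilvermanAEC2009, Thm. X.4.2 (b)] -/
theorem finite_torsionBy_selmerLayer (n : ℕ) : Finite (AddSubgroup.torsionBy (W.selmerLayer κ n) (p : ℤ)) :=
  W.finite_torsionBy_selmerGroupOver p (κ.layerSubgroup n) (κ.isOpen_layerSubgroup n)

/-- **Hachimori–Matsuno on the tree's plain Selmer tower — displayed residue = the Cassels–Tate layer pairing in its PRINTED
shape.** For ANY number field `K`, elliptic `W/K` with `E(K)[p] = 0` (`hK`), ANY `ℤ_p`-extension `κ` with topological generator
`γ`, ANY dual datum `D : W.SelmerDualData κ γ` with `D.X` finitely generated and `Λ`-torsion: if each layer `Sel_{p^∞}(E/K_n)`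
carries a biadditive `ℚ/ℤ`-valued pairing which is (ALT) alternating, (KER) has right kernel exactly the divisible elements
(Silverman X.4.14's "kernel on each side is exactly the subgroup of divisible elements", lifted from `Ш(E/K_n)[p^∞]`),
(GAL) is `conj_γ`-invariant and (ADJ) makes restriction adjoint to the tree's corestriction `coresLayer` — Hachimori–Matsuno's
"non-degenerate skew-symmetric Galois-equivariant pairing on `C_n`; the dual of restriction is corestriction" — then `D.X` has
no non-zero finite `Λ`-submodule. Kernel (this file): skew-symmetry, `p`-divisibility of `Sel_n^{div}`, finiteness of
`C_n = Sel_n/Sel_n^{div}` and representability of its characters (§1, from `Sel_n` `p`-primary with finite `p`-torsion); kernel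
(earlier files): injective layers, transitions, exhaustion, `Γ`-action, corestrictions + norm relation, stabilisation.
[cite: HachimoriMatsuno2000, Theorem and Corollary (i), proof p. 2540 L28–L45] [cite: SilvermanAEC2009, Thm. X.4.14]
[cite: MilneADT2006, I Thm. 6.13, Rem. 6.10] [cite: GreenbergLNM1716, §4 Prop. 4.14 (pp. 104–105)] -/
theorem SelmerDualData.forall_finite_eq_bot_of_casselsTateAlternating (hγ : κ.IsTopGenerator γ)
    (hK : ∀ P : W.toAffine.Point, p • P = 0 → P = 0) (D : W.SelmerDualData κ γ)
    [Module.Finite (IwasawaAlgebra p) D.X] (htor : D.IsTorsion)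
    (pair : ∀ n, W.selmerLayer κ n →+ W.selmerLayer κ n →+ AddCircle (1 : ℚ))
    (halt : ∀ n (x : W.selmerLayer κ n), pair n x x = 0)
    (hker : ∀ n (t : W.selmerLayer κ n), (∀ y, pair n y t = 0) ↔ t ∈ AddSubgroup.divisibleElements (W.selmerLayer κ n))
    (hinv : ∀ n (y t y' t' : W.selmerLayer κ n),
      (y' : W.subgroupH1 p (κ.layerSubgroup n)) = W.conjH1 p (κ.layerSubgroup n) γ y →
      (t' : W.subgroupH1 p (κ.layerSubgroup n)) = W.conjH1 p (κ.layerSubgroup n) γ t → pair n y' t' = pair n y t)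
    (hadj : ∀ n (t : W.selmerLayer κ (n + 1)) (t' : W.selmerLayer κ n)
      (y : W.selmerLayer κ n) (y' : W.selmerLayer κ (n + 1)),
      (t' : W.subgroupH1 p (κ.layerSubgroup n)) = W.coresLayer p κ n (t : W.subgroupH1 p (κ.layerSubgroup (n + 1))) →
      (y' : W.subgroupH1 p (κ.layerSubgroup (n + 1))) = W.resOfLe p (κ.layerSubgroup_antitone (Nat.le_succ n)) y →
      pair n y t' = pair (n + 1) y' t) :
    ∀ M : Submodule (IwasawaAlgebra p) D.X, Finite M → M = ⊥ := by
  have halg : ∀ n, (∀ t : W.selmerLayer κ n, (∀ y, pair n y t = 0) → ∃ t', (∀ y, pair n y t' = 0) ∧ p • t' = t) ∧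
      ∀ g : W.selmerLayer κ n →+ AddCircle (1 : ℚ), (∀ t, (∀ y, pair n y t = 0) → g t = 0) →
        ∃ c, ∀ y, g y = pair n y c := fun n ↦ by
    haveI := finite_torsionBy_selmerLayer W (p := p) κ n
    exact exists_forall_eq_pair_of_alternating_of_ker p (exists_pow_nsmul_eq_zero_selmerLayer W κ n) (pair n)
      (halt n) (hker n)
  exact SelmerDualData.forall_finite_eq_bot_of_casselsTatePackage W κ hγ hK D htor pair
    (fun n y t ↦ pair_eq_neg_of_alternating (pair n) (halt n) y t) hinv (fun n ↦ (halg n).1) (fun n ↦ (halg n).2)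
    fun n t ↦
      ⟨⟨W.coresLayer p κ n (t : W.subgroupH1 p (κ.layerSubgroup (n + 1))), W.coresLayer_mem_selmerLayer p κ n t.2⟩,
        W.layerToInfty_coresLayer p κ hγ n _, fun y y' hy' ↦ hadj n t _ y y' rfl hy'⟩

end Tower

/-! ## §3 Over `ℚ`: the binder `h414` from the Cassels–Tate layer pairing in its printed shape -/

/-- **`h414 = PRINT{Cassels–Tate pairing on Sel_{p^∞}(E/ℚ_n): alternating, kernel = divisible elements, Galois-equivariant,
res† = cor} ∘ KERNEL`.** If, for every globally minimal elliptic `W/ℚ`, every prime `p` with `p ∤ #E(ℚ)_tors`, every cyclotomic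
`κ` with topological generator `γ` and every layer `n`, `Sel_{p^∞}(E/ℚ_n)` carries a biadditive `ℚ/ℤ`-pairing which is
alternating, has right kernel exactly the divisible elements, is `conj_γ`-invariant and makes `res_{ℚ_{n+1}/ℚ_n}` adjoint to the
(kernel) corestriction `cor_{ℚ_{n+1}/ℚ_n}` [HachimoriMatsuno2000, p. 2540 L34–37; Milne *ADT* I §6; Silverman X.4.14], then the
Literature named fact `Greenberg1999.prop414_noFiniteSubmodule_of_not_dvd_torsionOrder` (Greenberg LNM 1716 Prop. 4.14,
`F = ℚ`; the PRINT binder `h414` of the K4 TOWER doors) HOLDS. CONDITIONAL; nothing asserted about any curve.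
[cite: HachimoriMatsuno2000, Theorem and Corollary (i), proof p. 2540 L28–L45]
[cite: GreenbergLNM1716, §4 Prop. 4.14 (pp. 104–105)] [cite: SilvermanAEC2009, Thm. X.4.14] -/
theorem prop414_of_casselsTateAlternating
    (hCT : ∀ (W : WeierstrassCurve ℚ) [W.IsElliptic] [W.IsGloballyMinimal] (p : ℕ) [Fact p.Prime],
      ¬ p ∣ W.torsionOrder →
      ∀ (κ : ZpExtension ℚ p) (γ : Field.absoluteGaloisGroup ℚ), κ.IsCyclotomic → κ.IsTopGenerator γ →
      ∃ pair : ∀ n, W.selmerLayer κ n →+ W.selmerLayer κ n →+ AddCircle (1 : ℚ),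
      (∀ n (x : W.selmerLayer κ n), pair n x x = 0) ∧
      (∀ n (t : W.selmerLayer κ n), (∀ y, pair n y t = 0) ↔ t ∈ AddSubgroup.divisibleElements (W.selmerLayer κ n)) ∧
      (∀ n (y t y' t' : W.selmerLayer κ n),
        (y' : W.subgroupH1 p (κ.layerSubgroup n)) = W.conjH1 p (κ.layerSubgroup n) γ y →
        (t' : W.subgroupH1 p (κ.layerSubgroup n)) = W.conjH1 p (κ.layerSubgroup n) γ t → pair n y' t' = pair n y t) ∧
      (∀ n (t : W.selmerLayer κ (n + 1)) (t' : W.selmerLayer κ n) (y : W.selmerLayer κ n) (y' : W.selmerLayer κ (n + 1)),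
        (t' : W.subgroupH1 p (κ.layerSubgroup n)) = W.coresLayer p κ n (t : W.subgroupH1 p (κ.layerSubgroup (n + 1))) →
        (y' : W.subgroupH1 p (κ.layerSubgroup (n + 1))) = W.resOfLe p (κ.layerSubgroup_antitone (Nat.le_succ n)) y →
        pair n y t' = pair (n + 1) y' t)) :
    Greenberg1999.prop414_noFiniteSubmodule_of_not_dvd_torsionOrder := by
  intro W _ _ p _ htors κ γ hκ hγ D _ hD N hN
  obtain ⟨pair, halt, hker, hinv, hadj⟩ := hCT W p htors κ γ hκ hγ
  refine SelmerDualData.forall_finite_eq_bot_of_casselsTateAlternating W κ hγ (fun P hP ↦ ?_) D hD pair halt hker hinv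
    hadj N hN
  -- `p ∤ #E(ℚ)_tors` ⟹ no rational point of order `p` (Lagrange in `E(ℚ)_tors`)
  by_contra hP0
  exact htors (dvd_torsionOrder_of_nsmul_eq_zero W p (by convert hP) hP0)

end Summit.BirchSwinnertonDyer.BirchSwinnertonDyer.Theorems.TowerHaMa

end
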